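/-
Copyright (c) 2026. All rights reserved.
Released under Apache 2.0 license as described in the file LICENSE.
Authors: abc-iut cell, campaign-S prover seat abc-iut-S8 (wave 2).
-/
import Mathlib.Analysis.Normed.Module.FiniteDimension
import Literature.IUT.LogVolume.RamificationInvariants
import Literature.IUT.LogVolume.LocalFieldVolume
import HarnessLib

/-!
# Embeddings of mixed-characteristic local fields are isometries; `μ̇^log_k(x) = [k:ℚ_p]·log ‖x‖`

Two classical facts used when the tensor packet `⊗_{i∈I} k_i` of [IUTchIV] Prop. 1.1–1.4 is
decomposed "as a direct sum of finitely many finite extensions of `ℚ_p`" (Mochizuki, *Inter-universal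
Teichmüller theory IV*, RIMS manuscript (Apr. 2020), §1, Prop. 1.4 (i), kurims p. 13) and volumes of
the sets `p^λ·(R_I)^∼` are computed factor by factor (Prop. 1.4 (iii), proof p. 14):

* `norm_map_algHom` — **uniqueness of the extended absolute value** (Neukirch, *Algebraic Number
  Theory*, Ch. II, Thm. (4.8)): every `ℚ_p`-algebra homomorphism `σ : k → L` from a locally compact
  normed field extension `k` of `ℚ_p` to a normed field extension `L` of `ℚ_p` is an ISOMETRY,
  `‖σ x‖ = ‖x‖`.  Proof given here: `σ` is `ℚ_p`-linear on the finite-dimensional `k`, hence bounded,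
  `‖σ x‖ ≤ C‖x‖`; applying this to `xⁿ` and taking `n`-th roots gives `‖σ x‖ ≤ ‖x‖`, and the same for
  `x⁻¹` gives the reverse inequality.
* `mulLogVolume_eq_mul_log_norm` — for `K` in the cell's norm-side setting (`‖p‖ = p⁻¹`,
  ramification index `e = absRamificationIdx p K`, residue degree `f = residueDegree p K`), the
  multiplicative log-volume of [AbsTopIII] Prop. 5.7 (i)(b) (`mulLogVolume`, `LocalFieldVolume.lean`,
  abc-iut-S2: `μ̇^log_k(x) = log μ_k(x·O_k)`) is `μ̇^log_k(x) = (e·f)·log ‖x‖` — i.e. the modulus of `x`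
  is `‖x‖^{[k:ℚ_p]}` (`e·f = [k:ℚ_p]`, `FundamentalIdentity.lean`); equivalently
  `μ^log_k(x·O_k) = (e·f)·log ‖x‖` (`localLogVolume_units_smul_closedBall_one`).
Nothing here is specific to IUT or bears on the disputed [IUTchIII] Cor. 3.12.
-/

noncomputable section

open MeasureTheory Set Metric
open scoped NormedField Pointwise

namespace Literature.IUT.LogVolume

open Literature.NumberTheory.GaloisRepresentations.Ultrametric

/-! ## Embeddings are isometries -/

section Isometry

variable {p : ℕ} [Fact p.Prime]
variable {k : Type*} [NormedField k] [NormedAlgebra ℚ_[p] k] [ProperSpace k]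
variable {L : Type*} [NormedField L] [NormedAlgebra ℚ_[p] L]

/-- The `n`-th root trick: if `aⁿ ≤ C·bⁿ` for all `n` (`a, b ≥ 0`, `C > 0`), then `a ≤ b`.
[cite: NeukirchANT1999, Ch. II Thm. (4.8)] -/
theorem le_of_pow_le_mul_pow {a b C : ℝ} (ha : 0 ≤ a) (hC : 0 < C)
    (h : ∀ n : ℕ, a ^ n ≤ C * b ^ n) : a ≤ b := by
  by_contra hab'
  have hab : b < a := not_le.mp hab'
  have hb : 0 ≤ b := by
    by_contra hb0'
    have hb0 : b < 0 := not_le.mp hb0'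
    have h1 := h 1
    rw [pow_one, pow_one] at h1
    nlinarith
  rcases hb.lt_or_eq with hbpos | hb0
  · -- `r = a/b > 1`, `rⁿ ≤ C` for all `n`: impossible
    have hr : 1 < a / b := by rw [lt_div_iff₀ hbpos, one_mul]; exact hab
    obtain ⟨n, hn⟩ := add_one_pow_unbounded_of_pos C (sub_pos.mpr hr)
    rw [sub_add_cancel] at hn
    have hle : (a / b) ^ n ≤ C := by
      rw [div_pow, div_le_iff₀ (pow_pos hbpos n)]
      exact h n
    exact absurd (hn.trans_le hle) (lt_irrefl C)
  · -- `b = 0`: then `a ≤ C·0`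
    have h1 := h 1
    rw [pow_one, pow_one, ← hb0, mul_zero] at h1
    linarith

/-- One half of the isometry: `‖σ x‖ ≤ ‖x‖` (boundedness of the `ℚ_p`-linear map `σ` on the
finite-dimensional `k`, then the `n`-th root trick with `σ(xⁿ) = σ(x)ⁿ`).
[cite: NeukirchANT1999, Ch. II Thm. (4.8)] -/
theorem norm_map_algHom_le (σ : k →ₐ[ℚ_[p]] L) (x : k) : ‖σ x‖ ≤ ‖x‖ := by
  haveI : FiniteDimensional ℚ_[p] k := FiniteDimensional.of_locallyCompactSpace ℚ_[p]
  set T : k →L[ℚ_[p]] L := LinearMap.toContinuousLinearMap σ.toLinearMap with hT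
  obtain ⟨C, hC, hbound⟩ := T.bound
  have hTx : ∀ y : k, T y = σ y := fun y ↦ rfl
  refine le_of_pow_le_mul_pow (norm_nonneg _) hC fun n ↦ ?_
  rw [← norm_pow, ← norm_pow, ← map_pow, ← hTx]
  exact hbound (x ^ n)

/-- **Embeddings of `p`-adic fields are isometries** (uniqueness of the extension of `|·|_p` to a
finite extension): for a `ℚ_p`-algebra homomorphism `σ : k → L` of normed field extensions of `ℚ_p`,
`k` locally compact, `‖σ x‖ = ‖x‖` for all `x`. [cite: NeukirchANT1999, Ch. II Thm. (4.8)] -/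
theorem norm_map_algHom (σ : k →ₐ[ℚ_[p]] L) (x : k) : ‖σ x‖ = ‖x‖ := by
  refine le_antisymm (norm_map_algHom_le σ x) ?_
  by_cases hx : x = 0
  · simp [hx]
  · have h := norm_map_algHom_le σ x⁻¹
    rw [map_inv₀, norm_inv, norm_inv] at h
    have hx' : 0 < ‖x‖ := norm_pos_iff.mpr hx
    have hσx : 0 < ‖σ x‖ := norm_pos_iff.mpr (by rw [map_ne_zero_iff σ σ.injective]; exact hx)
    exact (inv_le_inv₀ hσx hx').mp h

/-- In particular `σ` maps units of `R_k` to units of `R_L` and `‖σ x‖ = 1 ↔ ‖x‖ = 1`.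
[cite: NeukirchANT1999, Ch. II Thm. (4.8)] -/
theorem norm_map_algHom_eq_one_iff (σ : k →ₐ[ℚ_[p]] L) (x : k) : ‖σ x‖ = 1 ↔ ‖x‖ = 1 := by
  rw [norm_map_algHom σ x]

end Isometry

/-! ## `μ̇^log_k(x) = (e·f)·log ‖x‖` -/

section Modulus

variable (p : ℕ) [Fact p.Prime]
variable (K : Type*) [NontriviallyNormedField K] [instK : NormedAlgebra ℚ_[p] K] [IsUltrametricDist K]
  [ProperSpace K] [MeasurableSpace K] [BorelSpace K]

include instK in
/-- **`μ̇^log_k(x) = (e·f)·log ‖x‖`** for every `x ∈ k^×`: writing `‖x‖ = ‖ϖ‖ⁿ` (`ϖ` a uniformizer,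
`‖ϖ‖ = p^{−1/e}`), [AbsTopIII] Prop. 5.7 (i)(b) gives `μ̇^log_k(x) = −n·log q = −n·f·log p`
(`q = p^f`), which is `(e·f)·n·log ‖ϖ‖`. [cite: MochizukiAbsTopIII2015, Prop. 5.7 (i)(b) p. 138] -/
theorem mulLogVolume_eq_mul_log_norm (x : Kˣ) :
    mulLogVolume K x
      = ((absRamificationIdx p K : ℝ) * residueDegree p K) * Real.log ‖(x : K)‖ := by
  have hp : p.Prime := Fact.out
  have hp0 : (0 : ℝ) < p := by exact_mod_cast hp.pos
  obtain ⟨ϖ, hϖ⟩ := exists_isUniformizer (F := K)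
  set n : ℤ := hϖ.ordFun x with hn
  have hxn : ‖(x : K)‖ = ‖(ϖ : K)‖ ^ n := hϖ.norm_eq_zpow_ordFun x
  -- `x = ϖ^n · u` with `‖u‖ = 1`
  obtain ⟨u, hu, hxu⟩ := exists_eq_zpow_mul_of_norm_eq ϖ x n hxn
  have hmul : mulLogVolume K x = mulLogVolume K (ϖ ^ n) := by
    rw [mulLogVolume_eq_log_distribHaarChar, mulLogVolume_eq_log_distribHaarChar, hxu, map_mul,
      distribHaarChar_eq_one_of_norm_eq_one u hu, mul_one]
  rw [hmul, mulLogVolume_uniformizer_zpow K hϖ n, hxn, Real.log_zpow,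
    norm_eq_rpow_of_isUniformizer p K hϖ, Real.log_rpow hp0,
    show (residueCard K : ℝ) = (p : ℝ) ^ (residueDegree p K : ℝ) by
      rw [show residueCard K = p ^ residueDegree p K from card_residueField p K]
      push_cast
      rw [Real.rpow_natCast],
    Real.log_rpow hp0]
  have he : (absRamificationIdx p K : ℝ) ≠ 0 := by exact_mod_cast (absRamificationIdx_pos p K).ne'
  field_simp

include instK in
/-- The same for the log-volume of the translate `x·O_k`: `μ^log_k(x·O_k) = (e·f)·log ‖x‖`.
[cite: MochizukiAbsTopIII2015, Prop. 5.7 (i)(b) p. 138] -/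
theorem localLogVolume_units_smul_closedBall_one (x : Kˣ) :
    localLogVolume K ((x : K) • closedBall (0 : K) 1)
      = ((absRamificationIdx p K : ℝ) * residueDegree p K) * Real.log ‖(x : K)‖ := by
  rw [← mulLogVolume_eq_mul_log_norm p K x, mulLogVolume, mulVolume, localLogVolume_eq_log]
  rfl

include instK in
/-- And for the closed ball of radius `‖x‖`: `μ^log_k({‖z‖ ≤ ‖x‖}) = (e·f)·log ‖x‖` (`x ≠ 0`).
[cite: MochizukiAbsTopIII2015, Prop. 5.7 (i)(b) p. 138] -/
theorem localLogVolume_closedBall_norm_eq (x : Kˣ) :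
    localLogVolume K (closedBall (0 : K) ‖(x : K)‖)
      = ((absRamificationIdx p K : ℝ) * residueDegree p K) * Real.log ‖(x : K)‖ := by
  rw [← units_smul_unitBall, ← localLogVolume_units_smul_closedBall_one p K x]
  rfl

end Modulus

end Literature.IUT.LogVolume

end
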